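import Mathlib.MeasureTheory.Integral.Layercake
import Mathlib.MeasureTheory.Measure.Lebesgue.Basic
import Mathlib.MeasureTheory.Measure.WithDensity
import Mathlib.Analysis.SpecialFunctions.Log.PosLog
import Mathlib.Analysis.SpecialFunctions.ImproperIntegrals
import Mathlib.Analysis.SpecialFunctions.Pow.Real
import HarnessLib

/-!
# The one-dimensional bathtub principle and the Hardy–Littlewood layer-cake bound

Topic `Literature/Analysis/FunctionSpaces`. Two classical rearrangement facts, in the form in which
certified quadratures of singular integrands consume them, plus the explicit tail integral that
turns them into numbers:

* `setLIntegral_le_lintegral_Ioc_of_antitoneOn` — **bathtub principle** (Lieb–Loss Thm 1.14, the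
  monotone one-dimensional case): if `φ` is antitone on `(a, b]` and `E ⊆ (a, b]` has Lebesgue
  measure `≤ x ≤ b - a`, then `∫_E φ ≤ ∫_{(a, a+x]} φ` (Lebesgue integrals of `ENNReal.ofReal ∘ φ`);
* `lintegral_mul_le_of_antitoneOn_of_volume_superlevel_le` — **Hardy–Littlewood in layer-cake
  form** (Lieb–Loss Thm 1.13 + Thm 1.14; Hardy–Littlewood–Pólya Thm 378): if moreover `φ, ψ ≥ 0`
  on `(a, b]`, `ψ` a.e.-measurable there, and `vol{u ∈ (a,b] : τ < ψ u} ≤ m τ` with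
  `0 ≤ m τ ≤ b - a` for all `τ > 0`, then `∫_{(a,b]} φ ψ ≤ ∫_{τ>0} (∫_{(a, a + m τ]} φ) dτ`;
* `lintegral_min_exp_rpow_le` — `∫_{τ>0} min(L, M e^{-θτ})^p dτ ≤ L^p (θ⁻¹ log⁺(M/L) + (pθ)⁻¹)`
  for `0 < p ≤ 1` (the majorant met when the superlevel sets of `ψ` decay like `e^{-θτ}`, e.g.
  `ψ = log⁺(C/|ξ|)` under a sublevel set estimate for `ξ`:
  `Literature/Analysis/Fourier/SublevelLogIntegral.lean`).

Half-open intervals are used so that weights singular at the left end (`u^{p-1}` on `(0, b]`) are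
admissible; for Lebesgue measure `(a,b]` and `[a,b]` carry the same integrals.

## References
* [LiebLoss2001] E. H. Lieb, M. Loss, *Analysis*, 2nd ed., AMS (2001), Thm 1.13 (layer cake
  representation), Thm 1.14 (bathtub principle).
* [HardyLittlewoodPolya1952] G. H. Hardy, J. E. Littlewood, G. Pólya, *Inequalities*, CUP (1952),
  Thm 378 (rearrangement inequality for integrals).
-/

noncomputable section

open MeasureTheory Set Real
open scoped ENNReal

namespace Literature.Analysis.FunctionSpaces

/-! ### The bathtub principle on an interval -/

/-- **Bathtub principle (one-dimensional, monotone case).** Let `φ` be antitone on `(a, b]`,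
`0 ≤ x`, `a + x ≤ b`, and `E ⊆ (a, b]` measurable with `vol E ≤ x`. Then
`∫_E φ ≤ ∫_{(a, a + x]} φ` (as Lebesgue integrals of `ENNReal.ofReal ∘ φ`): the mass of an antitone
density over a set of prescribed measure is maximised by the initial segment. (Half-open intervals,
so that weights singular at `a`, such as `(u - a)^{p-1}`, are admissible.)
[cite: LiebLoss2001, Thm 1.14] -/
theorem setLIntegral_le_lintegral_Ioc_of_antitoneOn {φ : ℝ → ℝ} {a b x : ℝ}
    (hφ : AntitoneOn φ (Ioc a b)) (hx : 0 ≤ x) (hxb : a + x ≤ b) {E : Set ℝ}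
    (hE : MeasurableSet E) (hEs : E ⊆ Ioc a b) (hvol : volume E ≤ ENNReal.ofReal x) :
    ∫⁻ u in E, ENNReal.ofReal (φ u) ≤ ∫⁻ u in Ioc a (a + x), ENNReal.ofReal (φ u) := by
  rcases eq_or_lt_of_le hx with hx0 | hx0
  · -- `x = 0`: `E` is null
    have hE0 : volume E = 0 := le_antisymm (by simpa [← hx0] using hvol) bot_le
    simp [Measure.restrict_eq_zero.2 hE0]
  set I : Set ℝ := Ioc a (a + x) with hI
  set c : ℝ≥0∞ := ENNReal.ofReal (φ (a + x)) with hc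
  have hIm : MeasurableSet I := measurableSet_Ioc
  have haxI : a + x ∈ Ioc a b := ⟨by linarith, hxb⟩
  have hvolI : volume I = ENNReal.ofReal x := by
    rw [hI, Real.volume_Ioc]; congr 1; ring
  -- tail of `E` (beyond `a + x`, where `φ ≤ φ(a+x)`) versus the unused part of `I` (`φ ≥ φ(a+x)`)
  have h1 : ∫⁻ u in E \ I, ENNReal.ofReal (φ u) ≤ c * volume (E \ I) := by
    rw [← setLIntegral_const]
    refine setLIntegral_mono' (hE.diff hIm) fun u hu => ENNReal.ofReal_le_ofReal ?_
    have huab : u ∈ Ioc a b := hEs hu.1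
    have hnotI : a + x < u := by
      by_contra h
      exact hu.2 ⟨huab.1, not_lt.1 h⟩
    exact hφ haxI huab hnotI.le
  have h2 : c * volume (I \ E) ≤ ∫⁻ u in I \ E, ENNReal.ofReal (φ u) := by
    rw [← setLIntegral_const]
    refine setLIntegral_mono' (hIm.diff hE) fun u hu => ENNReal.ofReal_le_ofReal ?_
    have huI : u ∈ I := hu.1
    exact hφ ⟨huI.1, huI.2.trans hxb⟩ haxI huI.2
  have h3 : volume (E \ I) ≤ volume (I \ E) := by
    have hfin : volume (E ∩ I) ≠ ∞ :=
      ((measure_mono inter_subset_right).trans_lt (by rw [hvolI]; exact ENNReal.ofReal_lt_top)).ne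
    have key : volume (E ∩ I) + volume (E \ I) ≤ volume (E ∩ I) + volume (I \ E) := by
      rw [measure_inter_add_sdiff _ hIm, inter_comm, measure_inter_add_sdiff _ hE, hvolI]
      exact hvol
    exact (ENNReal.add_le_add_iff_left hfin).1 key
  -- split both integrals along the other set
  rw [← lintegral_inter_add_sdiff _ E hIm, ← lintegral_inter_add_sdiff _ I hE, inter_comm E I]
  have h4 : c * volume (E \ I) ≤ c * volume (I \ E) := by gcongr
  exact add_le_add le_rfl (h1.trans (h4.trans h2))

/-! ### Hardy–Littlewood in layer-cake form -/

/-- **Layer-cake composition (Hardy–Littlewood bound with a bathtub majorant).** Let `φ ≥ 0` be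
antitone on `(a, b]`, `ψ ≥ 0` measurable, and suppose the superlevel sets of `ψ` in `(a, b]` obey
`vol{u ∈ (a,b] : τ < ψ u} ≤ m τ` with `0 ≤ m τ` and `a + m τ ≤ b` for every `τ > 0`. Then
`∫_{(a,b]} φ ψ ≤ ∫_{τ > 0} ∫_{(a, a + m τ]} φ dτ` (Lebesgue integrals): layer cake for `ψ` against
the measure `φ du`, then the bathtub principle level by level.
[cite: LiebLoss2001, Thm 1.13, Thm 1.14] -/
theorem lintegral_mul_le_of_antitoneOn_of_volume_superlevel_le {φ ψ : ℝ → ℝ} {a b : ℝ}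
    (hφ : AntitoneOn φ (Ioc a b)) (hφ0 : ∀ u ∈ Ioc a b, 0 ≤ φ u)
    (hψ : AEMeasurable ψ (volume.restrict (Ioc a b)))
    (hψ0 : ∀ u ∈ Ioc a b, 0 ≤ ψ u) {m : ℝ → ℝ} (hm0 : ∀ τ, 0 < τ → 0 ≤ m τ)
    (hmb : ∀ τ, 0 < τ → a + m τ ≤ b)
    (hlevel : ∀ τ, 0 < τ → volume {u ∈ Ioc a b | τ < ψ u} ≤ ENNReal.ofReal (m τ)) :
    ∫⁻ u in Ioc a b, ENNReal.ofReal (φ u * ψ u) ≤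
      ∫⁻ τ in Ioi 0, ∫⁻ u in Ioc a (a + m τ), ENNReal.ofReal (φ u) := by
  set μ : Measure ℝ := volume.restrict (Ioc a b) with hμ
  have hφm : AEMeasurable (fun u => ENNReal.ofReal (φ u)) μ :=
    (aemeasurable_restrict_of_antitoneOn measurableSet_Ioc hφ).ennreal_ofReal
  -- a measurable modification `ψ'` of `ψ` on `(a, b]`
  set ψ' : ℝ → ℝ := hψ.mk ψ with hψ'
  have hψ'm : Measurable ψ' := hψ.measurable_mk
  have heq : ψ =ᵐ[μ] ψ' := hψ.ae_eq_mk
  have heq' : ∀ᵐ u ∂volume, u ∈ Ioc a b → ψ u = ψ' u := (ae_restrict_iff' measurableSet_Ioc).1 heq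
  set ν : Measure ℝ := μ.withDensity fun u => ENNReal.ofReal (φ u) with hν
  -- `∫ φ ψ du = ∫ ψ' dν`
  have step1 : ∫⁻ u in Ioc a b, ENNReal.ofReal (φ u * ψ u) =
      ∫⁻ u, ENNReal.ofReal (ψ' u) ∂ν := by
    rw [hν, lintegral_withDensity_eq_lintegral_mul₀ hφm hψ'm.ennreal_ofReal.aemeasurable]
    refine lintegral_congr_ae ?_
    filter_upwards [heq, ae_restrict_mem measurableSet_Ioc] with u hu hmem
    simp only [Pi.mul_apply]
    rw [ENNReal.ofReal_mul (hφ0 u hmem), hu]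
  -- layer cake for `ψ'` under `ν`
  have hac : ν ≪ μ := withDensity_absolutelyContinuous μ _
  have hψ0μ : ∀ᵐ u ∂μ, 0 ≤ ψ' u := by
    filter_upwards [heq, ae_restrict_mem measurableSet_Ioc] with u hu hmem
    rw [← hu]; exact hψ0 u hmem
  have step2 : ∫⁻ u, ENNReal.ofReal (ψ' u) ∂ν = ∫⁻ τ in Ioi 0, ν {u | τ < ψ' u} :=
    lintegral_eq_lintegral_meas_lt ν (hac.ae_le hψ0μ) hψ'm.aemeasurable
  rw [step1, step2]
  refine setLIntegral_mono' measurableSet_Ioi fun τ hτ => ?_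
  -- the level set, as a subset of `(a,b]` of measure `≤ m τ`
  have hmeas : MeasurableSet {u | τ < ψ' u} := measurableSet_lt measurable_const hψ'm
  have step3 : ν {u | τ < ψ' u} =
      ∫⁻ u in {u | τ < ψ' u} ∩ Ioc a b, ENNReal.ofReal (φ u) := by
    rw [hν, withDensity_apply _ hmeas, hμ, Measure.restrict_restrict hmeas]
  rw [step3]
  refine setLIntegral_le_lintegral_Ioc_of_antitoneOn hφ (hm0 τ hτ) (hmb τ hτ)
    (hmeas.inter measurableSet_Ioc) inter_subset_right ?_
  -- `{τ < ψ'} ∩ (a,b]` and `{u ∈ (a,b] | τ < ψ u}` differ by a null set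
  have hnull : volume {u | u ∈ Ioc a b ∧ ψ u ≠ ψ' u} = 0 := by
    rw [ae_iff] at heq'
    refine measure_mono_null (fun u hu => ?_) heq'
    simp only [mem_setOf_eq, Classical.not_imp]
    exact ⟨hu.1, hu.2⟩
  calc volume ({u | τ < ψ' u} ∩ Ioc a b)
      ≤ volume ({u ∈ Ioc a b | τ < ψ u} ∪ {u | u ∈ Ioc a b ∧ ψ u ≠ ψ' u}) := by
        refine measure_mono fun u hu => ?_
        by_cases h : ψ u = ψ' u
        · left; exact ⟨hu.2, by rw [h]; exact hu.1⟩
        · right; exact ⟨hu.2, h⟩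
    _ ≤ volume {u ∈ Ioc a b | τ < ψ u} + volume {u | u ∈ Ioc a b ∧ ψ u ≠ ψ' u} :=
        measure_union_le _ _
    _ ≤ ENNReal.ofReal (m τ) := by rw [hnull, add_zero]; exact hlevel τ hτ

/-! ### The explicit tail integral -/

/-- For `0 < L`, `0 ≤ M`, `0 < θ`: `M · exp(-θ τ₀) ≤ L` at `τ₀ = θ⁻¹ log⁺(M/L)` (the level from
which the exponential majorant is below the trivial one). [cite: LiebLoss2001, Thm 1.13] -/
theorem mul_exp_neg_mul_le_at_posLog {L M θ : ℝ} (hL : 0 < L) (hM : 0 ≤ M) (hθ : 0 < θ) :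
    M * exp (-θ * (θ⁻¹ * log⁺ (M / L))) ≤ L := by
  have hθτ : -θ * (θ⁻¹ * log⁺ (M / L)) = -log⁺ (M / L) := by field_simp
  rw [hθτ]
  rcases le_or_gt M L with hML | hML
  · have h1 : log⁺ (M / L) = 0 := by
      rw [posLog_eq_zero_iff, abs_of_nonneg (div_nonneg hM hL.le)]
      exact (div_le_one hL).2 hML
    rw [h1, neg_zero, exp_zero, mul_one]; exact hML
  · have hMpos : 0 < M := hL.trans hML
    have h1 : log⁺ (M / L) = log (M / L) := by
      refine posLog_eq_log ?_
      rw [abs_of_nonneg (div_nonneg hM hL.le)]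
      exact (one_le_div hL).2 hML.le
    rw [h1, exp_neg, exp_log (div_pos hMpos hL)]
    field_simp
    exact le_rfl

/-- **Tail integral.** For `0 < L`, `0 ≤ M`, `0 < θ`, `0 < p ≤ 1`:
`∫_{τ>0} min(L, M e^{-θτ})^p dτ ≤ L^p (θ⁻¹ log⁺(M/L) + (pθ)⁻¹)` (split at
`τ₀ = θ⁻¹ log⁺(M/L)`: the trivial bound before, the exponential one after).
[cite: LiebLoss2001, Thm 1.13] -/
theorem lintegral_min_exp_rpow_le {L M θ p : ℝ} (hL : 0 < L) (hM : 0 ≤ M) (hθ : 0 < θ)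
    (hp : 0 < p) :
    ∫⁻ τ in Ioi 0, ENNReal.ofReal (min L (M * exp (-θ * τ)) ^ p) ≤
      ENNReal.ofReal (L ^ p * (θ⁻¹ * log⁺ (M / L) + (p * θ)⁻¹)) := by
  set τ₀ : ℝ := θ⁻¹ * log⁺ (M / L) with hτ₀
  have hτ₀0 : 0 ≤ τ₀ := mul_nonneg (inv_nonneg.2 hθ.le) posLog_nonneg
  have hmin0 : ∀ τ, 0 ≤ min L (M * exp (-θ * τ)) := fun τ =>
    le_min hL.le (mul_nonneg hM (exp_pos _).le)
  have hLp : 0 ≤ L ^ p := rpow_nonneg hL.le p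
  -- split `(0, ∞) = (0, τ₀] ∪ (τ₀, ∞)`
  rw [← Ioc_union_Ioi_eq_Ioi hτ₀0]
  refine (lintegral_union_le _ _ _).trans ?_
  -- before `τ₀`: the trivial bound `L^p`
  have hA : ∫⁻ τ in Ioc 0 τ₀, ENNReal.ofReal (min L (M * exp (-θ * τ)) ^ p) ≤
      ENNReal.ofReal (L ^ p * τ₀) := by
    calc ∫⁻ τ in Ioc 0 τ₀, ENNReal.ofReal (min L (M * exp (-θ * τ)) ^ p)
        ≤ ∫⁻ _ in Ioc (0:ℝ) τ₀, ENNReal.ofReal (L ^ p) := by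
          refine setLIntegral_mono' measurableSet_Ioc fun τ _ => ENNReal.ofReal_le_ofReal ?_
          exact rpow_le_rpow (hmin0 τ) (min_le_left _ _) hp.le
      _ = ENNReal.ofReal (L ^ p * τ₀) := by
          rw [setLIntegral_const, Real.volume_Ioc, sub_zero, ← ENNReal.ofReal_mul hLp]
  -- after `τ₀`: the exponential bound, integrated exactly
  have hB : ∫⁻ τ in Ioi τ₀, ENNReal.ofReal (min L (M * exp (-θ * τ)) ^ p) ≤
      ENNReal.ofReal (L ^ p * (p * θ)⁻¹) := by
    have hpt : -(p * θ) < 0 := by nlinarith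
    have hint : IntegrableOn (fun τ : ℝ => M ^ p * exp (-(p * θ) * τ)) (Ioi τ₀) :=
      (integrableOn_exp_mul_Ioi hpt τ₀).const_mul _
    calc ∫⁻ τ in Ioi τ₀, ENNReal.ofReal (min L (M * exp (-θ * τ)) ^ p)
        ≤ ∫⁻ τ in Ioi τ₀, ENNReal.ofReal (M ^ p * exp (-(p * θ) * τ)) := by
          refine setLIntegral_mono' measurableSet_Ioi fun τ _ => ENNReal.ofReal_le_ofReal ?_
          calc min L (M * exp (-θ * τ)) ^ p ≤ (M * exp (-θ * τ)) ^ p :=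
                rpow_le_rpow (hmin0 τ) (min_le_right _ _) hp.le
            _ = M ^ p * exp (-(p * θ) * τ) := by
                rw [mul_rpow hM (exp_pos _).le, ← exp_mul]; ring_nf
      _ = ENNReal.ofReal (∫ τ in Ioi τ₀, M ^ p * exp (-(p * θ) * τ)) := by
          rw [ofReal_integral_eq_lintegral_ofReal hint]
          exact ae_of_all _ fun τ => mul_nonneg (rpow_nonneg hM p) (exp_pos _).le
      _ = ENNReal.ofReal ((M * exp (-θ * τ₀)) ^ p * (p * θ)⁻¹) := by
          congr 1
          rw [integral_const_mul, integral_exp_mul_Ioi hpt, mul_rpow hM (exp_pos _).le, ← exp_mul]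
          field_simp
      _ ≤ ENNReal.ofReal (L ^ p * (p * θ)⁻¹) := by
          refine ENNReal.ofReal_le_ofReal (mul_le_mul_of_nonneg_right ?_ (by positivity))
          exact rpow_le_rpow (mul_nonneg hM (exp_pos _).le)
            (mul_exp_neg_mul_le_at_posLog hL hM hθ) hp.le
  refine (add_le_add hA hB).trans ?_
  rw [← ENNReal.ofReal_add (mul_nonneg hLp hτ₀0) (mul_nonneg hLp (by positivity))]
  refine ENNReal.ofReal_le_ofReal (le_of_eq ?_)
  rw [hτ₀]; ring

end Literature.Analysis.FunctionSpaces

end
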